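import Summits.QuantumFields.BalabanUV.Beta.GAN24.BorderedFrameInverseBlocks

/-!
# `BalabanUV.Beta.GAN24.BorderedFrameInverseDecomp` — binder row G-an2-4 / (CONV-C), road P1-fibre, typer row **P1-E1** (DAG node N10c), part 3:
# the CANONICAL FRAME DECOMPOSITION `C = C₀ + E` of an arbitrary block matrix on `ι ⊕ Unit` and the one-call consumer form of the engine

NOT IN PRINT; OUR PROOF ATTEMPT (of the road; THIS file is [folklore] finite-dimensional linear algebra, Mathlib + parts 1–2 only).  HONEST FRAMING (cell
contract, verbatim): «discharging `BetaPertH` makes Bałaban's UV stability UNCONDITIONAL — a real constructive-QFT result; it is NOT the continuum limit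
and NOT the Clay problem.»  HONEST DEPENDENCY (verbatim): «continuum YM on T⁴ ⇐ BetaPertH ∧ nine spine estimates (0/9 proved); BetaPertH ⇐ (D1) ∧ (D4) ∧
CAP+tail; G-an2-4 gates asym, D1 and NE2/3/4.»  No cited fact, no wall binder, no `def … : Prop` hypothesis; discharges NOTHING of the K-slot of (CONV-C);
NOT summit progress.  Consumer: typer row P1-L08d (`GAN24/CapInverseSmall`): feed `C :=` the scaled capacitance `Ĉ` of rows P1-T00/P1-L08b and `u :=` the
frame vector of row P1-L08a.

## What is proved
Given `C : Matrix (ι ⊕ Unit) (ι ⊕ Unit) ℂ` with blocks `A = C.toBlocks₁₁`, column `v = colOf C`, row `w = rowOf C`, corner `γ = C cc`, and a unit vector `u`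
(`uᴴu = 1`), put `Π = projPerp u = 1 − uuᴴ`, `P = compT A u = Π A Π`, `ε = epsOf C u = uᴴAu`, `α = alphaOf C u = uᴴv`, `β = betaOf C u = w·u`,
`C₀ = frameOf C u = frameModel P u ε α β` (part 1).  Then
* `compT_mulVec_u`, `u_vecMul_compT` (`P u = 0`, `uᴴP = 0`); `compT_coercive` (transverse coercivity of `A` on `u⊥` IS that of `P`);
* `compT_eq` (`ΠAΠ = A − uuᴴA − Auuᴴ + ε uuᴴ`), `sub_frameOf_eq` (the remainder `E = C − C₀` blockwise:
  `[[uuᴴA + Auuᴴ − 2ε uuᴴ, v − αu], [w − βuᴴ, γ]]`) and **`norm_sub_frameOf_le`**: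
  `‖C − C₀‖ ≤ 3‖Au‖₂ + ‖uᴴA‖₂ + ‖v − αu‖₂ + ‖w − βuᴴ‖₂ + |γ|` — SMALL exactly when the `u`-column/row of `A`, the off-frame parts of the border and
  the corner are small (row P1-L08b's outputs);
* **`isUnit_and_inv_near_frameInv`** (the one-call form): with `K = 1/τ + 1/|β| + 1/|α| + |ε|/(|α||β|)`, if `A` is `τ`-coercive on `u⊥` (`τ > 0`),
  `α β ≠ 0` and `‖C − C₀‖·K ≤ 1/2`, then `C` is invertible, `‖C⁻¹‖ ≤ 2K` and `‖C⁻¹ − frameInv P u ε α β‖ ≤ 2K²‖C − C₀‖`; the blocks of `C⁻¹` then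
  follow from part 2's nearness lemmas (`norm_toBlocks₁₁_sub_pinvT_le`, `norm_uu_le`, `norm_col_sub_le`, `norm_row_sub_le`, `norm_cc_sub_le`).
-/

open Matrix WithLp Complex
open scoped ComplexConjugate Matrix.Norms.L2Operator InnerProductSpace

namespace Summit.QuantumFields.BalabanUV.Beta.GAN24.BorderedFrameInverseDecomp

open Summit.QuantumFields.BalabanUV.Beta.GAN24.BorderedFrameInverse
open Summit.QuantumFields.BalabanUV.Beta.GAN24.BorderedFrameInverseBlocks

variable {ι : Type*} [Fintype ι]

/-- [folklore] The `φc` column of a block matrix on `ι ⊕ Unit`. -/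
def colOf (C : Matrix (ι ⊕ Unit) (ι ⊕ Unit) ℂ) : ι → ℂ := fun i => C (Sum.inl i) (Sum.inr ())

/-- [folklore] The `cφ` row of a block matrix on `ι ⊕ Unit`. -/
def rowOf (C : Matrix (ι ⊕ Unit) (ι ⊕ Unit) ℂ) : ι → ℂ := fun i => C (Sum.inr ()) (Sum.inl i)

/-- [folklore] The longitudinal entry `ε = uᴴ A u` of the `φφ` block. -/
def epsOf (C : Matrix (ι ⊕ Unit) (ι ⊕ Unit) ℂ) (u : ι → ℂ) : ℂ := star u ⬝ᵥ (C.toBlocks₁₁ *ᵥ u)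

/-- [folklore] The `u`-component `α = uᴴ v` of the `φc` column. -/
def alphaOf (C : Matrix (ι ⊕ Unit) (ι ⊕ Unit) ℂ) (u : ι → ℂ) : ℂ := star u ⬝ᵥ colOf C

/-- [folklore] The `u`-component `β = w · u` of the `cφ` row. -/
def betaOf (C : Matrix (ι ⊕ Unit) (ι ⊕ Unit) ℂ) (u : ι → ℂ) : ℂ := rowOf C ⬝ᵥ u

variable [DecidableEq ι]

/-- [folklore] The orthogonal projector `Π = 1 − uuᴴ` onto `u⊥` (for `uᴴu = 1`). -/
def projPerp (u : ι → ℂ) : Matrix ι ι ℂ := 1 - uuH u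

/-- [folklore] The TRANSVERSE COMPRESSION `Π A Π` of a square block. -/
def compT (A : Matrix ι ι ℂ) (u : ι → ℂ) : Matrix ι ι ℂ := projPerp u * A * projPerp u

/-- [folklore] The CANONICAL FRAME MODEL of `C` in the frame `u`: `frameModel (Π A Π) u (uᴴAu) (uᴴv) (w·u)`. -/
noncomputable def frameOf (C : Matrix (ι ⊕ Unit) (ι ⊕ Unit) ℂ) (u : ι → ℂ) : Matrix (ι ⊕ Unit) (ι ⊕ Unit) ℂ :=
  frameModel (compT C.toBlocks₁₁ u) u (epsOf C u) (alphaOf C u) (betaOf C u)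

variable {u : ι → ℂ}

/-- [folklore] `Π u = 0`. -/
theorem projPerp_mulVec_u (hu : star u ⬝ᵥ u = 1) : projPerp u *ᵥ u = 0 := by
  rw [projPerp, sub_mulVec, one_mulVec, uuH_mulVec, hu, one_smul, sub_self]

/-- [folklore] `uᴴ Π = 0`. -/
theorem u_vecMul_projPerp (hu : star u ⬝ᵥ u = 1) : star u ᵥ* projPerp u = 0 := by
  rw [projPerp, vecMul_sub, vecMul_one, vecMul_uuH, hu, one_smul, sub_self]

/-- [folklore] `Π x = x` for `x ⊥ u`. -/
theorem projPerp_mulVec_of_perp {x : ι → ℂ} (hx : star u ⬝ᵥ x = 0) : projPerp u *ᵥ x = x := by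
  rw [projPerp, sub_mulVec, one_mulVec, uuH_mulVec, hx, zero_smul, sub_zero]

/-- [folklore] `xᴴ (Π y) = xᴴ y` for `x ⊥ u`. -/
theorem star_dotProduct_projPerp_mulVec {x : ι → ℂ} (hx : star u ⬝ᵥ x = 0) (y : ι → ℂ) :
    star x ⬝ᵥ (projPerp u *ᵥ y) = star x ⬝ᵥ y := by
  have hxu : star x ⬝ᵥ u = 0 := by
    rw [show u = star (star u) from (star_star u).symm, star_dotProduct_star, hx, star_zero]
  rw [projPerp, sub_mulVec, one_mulVec, uuH_mulVec, dotProduct_sub, dotProduct_smul, hxu, smul_zero, sub_zero]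

/-- [folklore] `P u = 0` for the compression `P = Π A Π`. -/
theorem compT_mulVec_u (hu : star u ⬝ᵥ u = 1) (A : Matrix ι ι ℂ) : compT A u *ᵥ u = 0 := by
  rw [compT, ← mulVec_mulVec, projPerp_mulVec_u hu, mulVec_zero]

/-- [folklore] `uᴴ P = 0` for the compression `P = Π A Π`. -/
theorem u_vecMul_compT (hu : star u ⬝ᵥ u = 1) (A : Matrix ι ι ℂ) : star u ᵥ* compT A u = 0 := by
  rw [compT, Matrix.mul_assoc, ← vecMul_vecMul, u_vecMul_projPerp hu, zero_vecMul]

/-- [folklore] On `u⊥` the quadratic form of `Π A Π` IS that of `A`. -/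
theorem star_dotProduct_compT_mulVec {x : ι → ℂ} (hx : star u ⬝ᵥ x = 0) (A : Matrix ι ι ℂ) :
    star x ⬝ᵥ (compT A u *ᵥ x) = star x ⬝ᵥ (A *ᵥ x) := by
  rw [compT, ← mulVec_mulVec, ← mulVec_mulVec, projPerp_mulVec_of_perp hx, star_dotProduct_projPerp_mulVec hx]

/-- [folklore] **Transverse coercivity transfers from `A` to `Π A Π`.** -/
theorem compT_coercive {A : Matrix ι ι ℂ} {τ : ℝ}
    (hco : ∀ x : ι → ℂ, star u ⬝ᵥ x = 0 → τ * (∑ i, ‖x i‖ ^ 2) ≤ (star x ⬝ᵥ (A *ᵥ x)).re) :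
    ∀ x : ι → ℂ, star u ⬝ᵥ x = 0 → τ * (∑ i, ‖x i‖ ^ 2) ≤ (star x ⬝ᵥ (compT A u *ᵥ x)).re := fun x hx => by
  rw [star_dotProduct_compT_mulVec hx]; exact hco x hx

omit [DecidableEq ι] in
/-- [folklore] `uuᴴ A uuᴴ = (uᴴAu) uuᴴ`. -/
theorem uuH_mul_mul_uuH (A : Matrix ι ι ℂ) (u : ι → ℂ) : uuH u * A * uuH u = (star u ⬝ᵥ (A *ᵥ u)) • uuH u := by
  rw [uuH_mul, uuH, vecMulVec_mul_vecMulVec, ← dotProduct_mulVec, vecMulVec_smul]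

/-- [folklore] `Π A Π = A − uuᴴA − Auuᴴ + (uᴴAu) uuᴴ`. -/
theorem compT_eq (A : Matrix ι ι ℂ) (u : ι → ℂ) :
    compT A u = A - uuH u * A - A * uuH u + (star u ⬝ᵥ (A *ᵥ u)) • uuH u := by
  rw [compT, projPerp, sub_mul, one_mul, mul_sub, mul_one, sub_mul, uuH_mul_mul_uuH]
  abel

omit [Fintype ι] [DecidableEq ι] in
/-- [folklore] A block matrix on `ι ⊕ Unit` in terms of its four blocks. -/
theorem eq_fromBlocks (C : Matrix (ι ⊕ Unit) (ι ⊕ Unit) ℂ) :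
    C = fromBlocks C.toBlocks₁₁ (replicateCol Unit (colOf C)) (replicateRow Unit (rowOf C))
      (of fun _ _ => C (Sum.inr ()) (Sum.inr ())) := by
  ext (i | i) (j | j) <;> rfl

/-- [folklore] **THE REMAINDER `E = C − C₀` BLOCKWISE**: `[[uuᴴA + Auuᴴ − 2ε uuᴴ, v − αu], [w − βuᴴ, γ]]`. -/
theorem sub_frameOf_eq (C : Matrix (ι ⊕ Unit) (ι ⊕ Unit) ℂ) (u : ι → ℂ) :
    C - frameOf C u =
      fromBlocks (uuH u * C.toBlocks₁₁ + C.toBlocks₁₁ * uuH u - (2 * epsOf C u) • uuH u)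
        (replicateCol Unit (colOf C - alphaOf C u • u)) (replicateRow Unit (rowOf C - betaOf C u • star u))
        (of fun _ _ => C (Sum.inr ()) (Sum.inr ())) := by
  rw [show C - frameOf C u = C + -frameOf C u from sub_eq_add_neg _ _]
  nth_rw 1 [eq_fromBlocks C]
  rw [frameOf, frameModel, compT_eq, ← epsOf, fromBlocks_neg, fromBlocks_add]
  have e1 : C.toBlocks₁₁ + -(C.toBlocks₁₁ - uuH u * C.toBlocks₁₁ - C.toBlocks₁₁ * uuH u + epsOf C u • uuH u
      + epsOf C u • uuH u) = uuH u * C.toBlocks₁₁ + C.toBlocks₁₁ * uuH u - (2 * epsOf C u) • uuH u := by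
    rw [mul_smul, two_smul]; abel
  have e2 : replicateCol Unit (colOf C) + -replicateCol Unit (alphaOf C u • u) = replicateCol Unit (colOf C - alphaOf C u • u) := by
    ext i j; simp [sub_eq_add_neg]
  have e3 : replicateRow Unit (rowOf C) + -replicateRow Unit (betaOf C u • star u) =
      replicateRow Unit (rowOf C - betaOf C u • star u) := by
    ext i j; simp [sub_eq_add_neg]
  have e4 : (of fun _ _ => C (Sum.inr ()) (Sum.inr ()) : Matrix Unit Unit ℂ) + -0 = of fun _ _ => C (Sum.inr ()) (Sum.inr ()) := by
    rw [neg_zero, add_zero]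
  rw [e1, e2, e3, e4]

/-- [folklore] `‖a bᴴ‖ ≤ ‖a‖₂ ‖b‖₂` for rank-one matrices. -/
theorem norm_vecMulVec_le (a b : ι → ℂ) :
    ‖vecMulVec a (star b)‖ ≤ ‖(toLp 2 a : EuclideanSpace ℂ ι)‖ * ‖(toLp 2 b : EuclideanSpace ℂ ι)‖ := by
  rw [Matrix.l2_opNorm_def]
  refine ContinuousLinearMap.opNorm_le_bound _ (by positivity) fun x => ?_
  change ‖(toLp 2 (vecMulVec a (star b) *ᵥ ofLp x) : EuclideanSpace ℂ ι)‖ ≤ _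
  rw [vecMulVec_mulVec, op_smul_eq_smul, toLp_smul, norm_smul]
  calc ‖star b ⬝ᵥ ofLp x‖ * ‖(toLp 2 a : EuclideanSpace ℂ ι)‖
      ≤ (‖(toLp 2 b : EuclideanSpace ℂ ι)‖ * ‖x‖) * ‖(toLp 2 a : EuclideanSpace ℂ ι)‖ := by
        gcongr; exact norm_star_dotProduct_le b x
    _ = _ := by ring

/-- [folklore] `‖uuᴴ‖ ≤ 1` for a unit vector. -/
theorem norm_uuH_le (hu : star u ⬝ᵥ u = 1) : ‖uuH u‖ ≤ 1 := by
  have h := norm_vecMulVec_le u u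
  rwa [norm_toLp_of_unit hu, mul_one, ← uuH] at h

/-- [folklore] **THE REMAINDER IS SMALL WHEN THE FRAME DATA ARE**: `‖C − C₀‖ ≤ 3‖Au‖₂ + ‖uᴴA‖₂ + ‖v − αu‖₂ + ‖w − βuᴴ‖₂ + |γ|`. -/
theorem norm_sub_frameOf_le (hu : star u ⬝ᵥ u = 1) (C : Matrix (ι ⊕ Unit) (ι ⊕ Unit) ℂ) :
    ‖C - frameOf C u‖ ≤
      3 * ‖(toLp 2 (C.toBlocks₁₁ *ᵥ u) : EuclideanSpace ℂ ι)‖ + ‖(toLp 2 (star u ᵥ* C.toBlocks₁₁) : EuclideanSpace ℂ ι)‖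
        + ‖(toLp 2 (colOf C - alphaOf C u • u) : EuclideanSpace ℂ ι)‖
        + ‖(toLp 2 (rowOf C - betaOf C u • star u) : EuclideanSpace ℂ ι)‖ + ‖C (Sum.inr ()) (Sum.inr ())‖ := by
  rw [sub_frameOf_eq]
  refine (norm_fromBlocks_le _ _ _ _).trans ?_
  have h1 : ‖uuH u * C.toBlocks₁₁‖ ≤ ‖(toLp 2 (star u ᵥ* C.toBlocks₁₁) : EuclideanSpace ℂ ι)‖ := by
    have h := norm_vecMulVec_le u (star (star u ᵥ* C.toBlocks₁₁))
    rw [star_star, norm_toLp_of_unit hu, one_mul, norm_toLp_star] at h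
    rwa [uuH_mul]
  have h2 : ‖C.toBlocks₁₁ * uuH u‖ ≤ ‖(toLp 2 (C.toBlocks₁₁ *ᵥ u) : EuclideanSpace ℂ ι)‖ := by
    have h := norm_vecMulVec_le (C.toBlocks₁₁ *ᵥ u) u
    rw [norm_toLp_of_unit hu, mul_one] at h
    rwa [mul_uuH]
  have hε : ‖epsOf C u‖ ≤ ‖(toLp 2 (C.toBlocks₁₁ *ᵥ u) : EuclideanSpace ℂ ι)‖ := by
    have h := norm_star_dotProduct_le u (toLp 2 (C.toBlocks₁₁ *ᵥ u))
    rw [ofLp_toLp, norm_toLp_of_unit hu, one_mul] at h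
    exact h
  have h3 : ‖(2 * epsOf C u) • uuH u‖ ≤ 2 * ‖(toLp 2 (C.toBlocks₁₁ *ᵥ u) : EuclideanSpace ℂ ι)‖ := by
    rw [norm_smul, norm_mul, Complex.norm_two]
    calc 2 * ‖epsOf C u‖ * ‖uuH u‖ ≤ 2 * ‖(toLp 2 (C.toBlocks₁₁ *ᵥ u) : EuclideanSpace ℂ ι)‖ * 1 := by
          gcongr; exact norm_uuH_le hu
      _ = _ := mul_one _
  have h4 := norm_replicateCol_unit_le (colOf C - alphaOf C u • u)
  have h5 := norm_replicateRow_unit_le (rowOf C - betaOf C u • star u)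
  have h6 := norm_unitBlock_le (C (Sum.inr ()) (Sum.inr ()))
  have h7 : ‖uuH u * C.toBlocks₁₁ + C.toBlocks₁₁ * uuH u - (2 * epsOf C u) • uuH u‖ ≤
      ‖uuH u * C.toBlocks₁₁‖ + ‖C.toBlocks₁₁ * uuH u‖ + ‖(2 * epsOf C u) • uuH u‖ :=
    (norm_sub_le _ _).trans (by gcongr; exact norm_add_le _ _)
  linarith

/-- **THE ONE-CALL FORM OF THE ENGINE** ([folklore]; typer row P1-E1 for row P1-L08d).  Let `K = 1/τ + 1/|β| + 1/|α| + |ε|/(|α||β|)` with the canonical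
frame data `ε = uᴴAu`, `α = uᴴv`, `β = w·u` of `C` in the unit frame `u`.  If the `φφ` block `A` is `τ`-coercive on `u⊥` (`τ > 0`), `α β ≠ 0`, and the
remainder is small, `‖C − frameOf C u‖ · K ≤ 1/2` (see `norm_sub_frameOf_le`), then `C` is invertible, `‖C⁻¹‖ ≤ 2K`, and
`‖C⁻¹ − frameInv (ΠAΠ) u ε α β‖ ≤ 2K² ‖C − frameOf C u‖` (blocks of `frameInv`: part 2, `frameInv_toBlocks₁₁/col/row/cc`). -/
theorem isUnit_and_inv_near_frameInv (hu : star u ⬝ᵥ u = 1) {τ : ℝ} (hτ : 0 < τ) (C : Matrix (ι ⊕ Unit) (ι ⊕ Unit) ℂ)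
    (hco : ∀ x : ι → ℂ, star u ⬝ᵥ x = 0 → τ * (∑ i, ‖x i‖ ^ 2) ≤ (star x ⬝ᵥ (C.toBlocks₁₁ *ᵥ x)).re)
    (hα : alphaOf C u ≠ 0) (hβ : betaOf C u ≠ 0)
    (hE : ‖C - frameOf C u‖ *
      (1 / τ + ‖betaOf C u‖⁻¹ + ‖alphaOf C u‖⁻¹ + ‖epsOf C u‖ / (‖alphaOf C u‖ * ‖betaOf C u‖)) ≤ 1 / 2) :
    IsUnit C ∧
      ‖C⁻¹‖ ≤ 2 * (1 / τ + ‖betaOf C u‖⁻¹ + ‖alphaOf C u‖⁻¹ + ‖epsOf C u‖ / (‖alphaOf C u‖ * ‖betaOf C u‖)) ∧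
      ‖C⁻¹ - frameInv (compT C.toBlocks₁₁ u) u (epsOf C u) (alphaOf C u) (betaOf C u)‖ ≤
        2 * (1 / τ + ‖betaOf C u‖⁻¹ + ‖alphaOf C u‖⁻¹ + ‖epsOf C u‖ / (‖alphaOf C u‖ * ‖betaOf C u‖)) ^ 2 *
          ‖C - frameOf C u‖ := by
  have h := frame_neumann_of_coercive (P := compT C.toBlocks₁₁ u) (ε := epsOf C u) hu (compT_mulVec_u hu _)
    (u_vecMul_compT hu _) hτ (compT_coercive hco) hα hβ (E := C - frameOf C u) hE
  have hC : frameModel (compT C.toBlocks₁₁ u) u (epsOf C u) (alphaOf C u) (betaOf C u) + (C - frameOf C u) = C := by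
    rw [frameOf, add_sub_cancel]
  rw [hC] at h
  exact h

end Summit.QuantumFields.BalabanUV.Beta.GAN24.BorderedFrameInverseDecomp
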